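import Summits.BirchSwinnertonDyer.BirchSwinnertonDyer.Theorems.KimAtThreeShallowEqDeepAnomalousPortOfZetaBody
import Summits.BirchSwinnertonDyer.BirchSwinnertonDyer.Theorems.KimAtThreeShallowEqDeepAnomalousValueRowsOfZetaBody
import Summits.BirchSwinnertonDyer.BirchSwinnertonDyer.Theorems.KimAtThreeShallowEqDeepAnomalousCertSupply
import Summits.BirchSwinnertonDyer.BirchSwinnertonDyer.Theorems.KimAtThreeShallowEqDeepPortNonAddFineKato
import HarnessLib

/-!
# Route `KimAtThreeKolyvagin` (W2): the off-stratum port on the good ANOMALOUS rows FROM THE FINE KATO PACKAGE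
# (C1_τ) ALONE — and the row conclusions of 19599 / 19077 / LEAF / 19679 there

Cell `bsd-addord`, seat `bsd-addord-w2-c4` (gen 9; owner of crux 19599 `ShallowEqDeepOffKatoStratum`, item
19077 `ShallowEqDeepAtTorsionFree`).  `--supports` 19077.  HONEST FRAMING: END THEOREMS WITH DISPLAYED
HYPOTHESES (no definition, no named fact, no instance, no `sorry`); the fine Kato package (C1_τ) and the published
inputs ([S24] Thm 4.4 (1)(2), GZK, Poitou–Tate) are DISPLAYED; nothing asserted, nothing booked; 19560 / 19599 /
19077 stay OPEN; BSD is not proved by any of this.  Credit: this is the seat's gen-8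
`KimAtThreeShallowEqDeepPortNonAddFineKato` (p487145) VERBATIM with (C1′) ↦ (C1_τ), the non-anomaly certificate
↦ `3 ∤ N`, and the gen-9 twisted chain (`…AnomalousPortOfZetaBody`, `…AnomalousValueRowsOfZetaBody`,
`…AnomalousCertSupply`) in place of the gen-8 scaled chain; rows by gen 7's `KimAtThreeShallowEqDeepPortRows`.

## (C1_τ) — the fine Kato package with the TWISTED rider (the ONE displayed construction object)

`∃ ι κK Λ Λfin, κK ≠ 0 ∧ (∃ u : ℚ, u = κK ∧ v₃(u) = 0) ∧ (∀ j, Λfin j onto ℤ/3^{j+1} on 𝓕_can(v₃) with kernel the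
Kummer part) ∧ (∀ j, the TWISTED scalar clause (ii_τ) of `KimAtThreeShallowEqDeepAnomalousRider` with `a₃ = t₃`)
∧ ∀ c d a A (guards), ∃ z x, ZetaBody W 3 f ι κK Λ c d a A z x` — i.e. kim3's (C1) / the seat's gen-8 (C1′) with
the rider's clause (ii) stated on the Euler-factor lattice `(1 ⊗ (3 − a₃σ₃⁻¹ + σ₃⁻²))·L_int` with scalar
`s·(4 − a₃) = s·#Ẽ(𝔽₃)`.  STATUS: the same ONE construction object as (C1) (`exp*` + [BK90] §3 + Kato Thm 9.7 /
6.6 (1) + R-κ) read through the seat's LATTICE LEMMA `exp*_ω(H¹(K,T)) = E₃(φ⁻¹)·𝓞_K` (unramified `K`,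
`E(K)[3] = 0`; memo W2C4-ANOMALOUS-PORT-g9.md) with `Λfin := exp*_ω/E₃(1)`: TRUE for Kato's witnesses on the
good ANOMALOUS `t = 0` rows (`a₃ ∈ {1, −2}`), where gen 8's (C1′) is NOT (one digit lost) — and ALSO on the good
non-anomalous rows at the levels where `E(K)[3] = 0`.

## What

§1 `portUnlocked_zero_of_fineKatoτ_of_good` : the UNLOCKED port at `(W, v₃, η, P)` ⟸ surj(3) ∧ `#E(ℚ₃)[3] = 1`
∧ `3 ∤ N` ∧ (C1_τ).  §2 `portTwoExp_zero_…` (PortRows currency, instance binders discharged).  §3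
`shallowEqDeep_row_of_fineKatoτ_of_good` (19599 / 19077's conclusion at the row), `leaf_row_…` (the LEAF
`N11.KimAtThreeRankZeroPUB` at the row), `lower_row_…` (19679 / 19075) ⟸ [S24](1)(2) ∧ GZK ∧ PT ∧ tower ∧
`t = 0` ∧ `3`-integral symbols ∧ `ord(δ̃) = 0` ∧ `v₃` ∧ `η` ∧ `3 ∤ N` ∧ (C1_τ).  READING for the planner: the
GOOD-ANOMALOUS rows of 19599 — gen 8's "remaining typed obstruction" — reduce to PUB ∧ (C1_τ), the same debt class
as 19560's (C1); what remains of 19599 off (C1) are acc6/acc1's two-exponent rows (IV/IV*, `3 ∣ c₃`) and the Manin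
rows `3 ∣ c_{D₀}`.  HONEST LIMITS: `t = 0` only; (C1_τ) displayed; nothing booked.

References: [Kato2004Asterisque] (8.1.3), §6.2, Thm. 6.6 (1), §9.4, Thm. 9.7, Ex. 13.3; [Kim2022StructureSelmer]
Lemma 3.4, Cor. 3.5, Thm. 3.13, Thm. 1.9 (6); [Kim2025RefinedTNC] Thm 1.1/1.2; [MazurRubin2004] Thm. 3.2.4,
4.4.1, 5.2.12, App. A; [Sakamoto2024] Thm. 4.4; [Manin1972] Prop. 1.4, Thm. 1.6; [BlochKato1990] §3.
-/

set_option autoImplicit false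
-- the Theorems namespace of a single-conjunct summit repeats the summit name by design (D-0017)
set_option linter.dupNamespace false

noncomputable section

open scoped NumberField TensorProduct ContRepresentation Classical
open CategoryTheory Field Function Finset IsDedekindDomain NumberField WeierstrassCurve
open Rat.HeightOneSpectrum
open Literature.NumberTheory.GaloisRepresentations Literature.NumberTheory.GaloisCohomology
open Literature.NumberTheory.GaloisRepresentations.DiscreteGaloisModule
open Literature.NumberTheory.EllipticCurves Literature.NumberTheory.EllipticCurves.ModularForms
open Literature.NumberTheory.EllipticCurves.Kato2004
open Literature.NumberTheory.EllipticCurves.Kato2004.EulerSystemValues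

namespace Summit.BirchSwinnertonDyer.BirchSwinnertonDyer.Theorems.KimAtThreeShallowEqDeepAnomalousFineKato

open Summit.BirchSwinnertonDyer.Rank1Residual.GaloisImage
open Summit.BirchSwinnertonDyer.BirchSwinnertonDyer.Theorems

/-! ### §1 The unlocked port at a good (anomalous allowed) `t = 0` row from (C1_τ) alone -/

section Row

variable (W : WeierstrassCurve ℚ) [W.IsElliptic] [W.IsGloballyMinimal]
  [ContinuousSMul ℤ_[3] (W.tateModule 3)] [Module.Free ℤ_[3] (W.tateModule 3)]
  [Module.Finite ℤ_[3] (W.tateModule 3)]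

set_option backward.isDefEq.respectTransparency false in
/-- **The UNLOCKED Kato–Kurihara port at a good (ANOMALOUS allowed) `t = 0` row FROM (C1_τ) ALONE.**
Displayed: the parametrisation datum `P` at the conductor level (`hN`), surj(3), the place `v₃ ∣ 3`,
`#E(ℚ₃)[3] = 1` (the cruxes' `t = 0` binder verbatim), `3 ∤ N` (good reduction at `3`), and (C1_τ) at the row — Kato's `ZetaBody` family for `P.f` with R-κ, the (Λ)-clauses and the
TWISTED scalar clauses (ii_τ) (`KimAtThreeShallowEqDeepAnomalousRider`).  Inside: the auxiliary cusp datum with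
its certificates from `certSupply_row_anomalous` (depletion certificate away from `3`), `ht0` by transport
`ℚ_[3] ≃ ℚ_w` (`LocalTorsion3`), the witnesses from (C1_τ), the twisted value rows by
`valueRow_twist_of_zetaBody`, the port by `katoKuriharaPortUnlocked_zero_of_zetaBody_of_unramified_twist` (no `hbad`).  Concluded: the
unlocked port at `(W, v₃, η, P)` for EVERY generator family `η`.  Nothing asserted; nothing booked.
[cite: Kato2004Asterisque, (8.1.3) (p. 180), §9.4 (p. 188), Thm. 9.7 (p. 189), Thm. 6.6 (1) (p. 163) and Ex. 13.3 (pp. 224–225)]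
[cite: Kim2022StructureSelmer, Lemma 3.3 and Thm. 3.13 (arXiv v3 pp. 17–18, 26–28)]
[cite: MazurRubin2004, Thm. 3.2.4 and App. A (Lemma A.1, Remark A.5)] [cite: Manin1972, Prop. 1.4  Thm. 1.6] -/
theorem portUnlocked_zero_of_fineKatoτ_of_good
    {N : ℕ} [NeZero N] (P : ModularParametrizationData W N) (hN : N = W.conductorNorm ℤ)
    (hsurj : W.HasSurjectiveModNGaloisRep ((3 : ℕ) : ℤ))
    {v₃ : HeightOneSpectrum (𝓞 ℚ)} (hv₃ : ((3 : ℕ) : 𝓞 ℚ) ∈ v₃.asIdeal)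
    (ht : Nat.card {Q : (W.baseChange ℚ_[3]).toAffine.Point // (3 : ℕ) • Q = 0} = 1)
    {t₃ : ℤ} (ht₃ : cuspCoeff P.f 3 = t₃) (hN3 : ¬ 3 ∣ N)
    -- (C1_τ) the fine Kato package AT THE ROW with the (P-EXP) riders AT EXPONENT `1`
    (hC1 : ∃ (ι : (n : ℕ) → (CyclotomicField n ℚ →+* ℂ)) (κK : ℝ)
        (Λ : ∀ (k' : ℕ) (r : Finset (HeightOneSpectrum (𝓞 ℚ))),
          H1 (tateRep W 3) (cycSubgroup 3 k' r) →ₗ[ℤ_[3]]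
            ℚ_[3] ⊗[ℚ] CyclotomicField (cycLevel 3 k' r) ℚ)
        (Λfin : ∀ j : ℕ, galoisCohomology
          ((W.torsionGaloisModule (((3 : ℕ) : ℤ) ^ j * ((3 : ℕ) : ℤ))).toLocal (Sum.inr v₃)) 1 →+
            ZMod (3 ^ (j + 1))),
        κK ≠ 0 ∧ (∃ u : ℚ, (u : ℝ) = κK ∧ padicValRat 3 u = 0) ∧
        (∀ j : ℕ, (∀ c : ZMod (3 ^ (j + 1)), ∃ x ∈ propagatedSelmerStructure W 3 j (Sum.inr v₃), Λfin j x = c) ∧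
          (∀ x ∈ propagatedSelmerStructure W 3 j (Sum.inr v₃),
            Λfin j x = 0 ↔ x ∈ W.kummerSelmerStructure (((3 : ℕ) : ℤ) ^ j * ((3 : ℕ) : ℤ)) (Sum.inr v₃))) ∧
            (∀ (j : ℕ) (r : Finset (HeightOneSpectrum (𝓞 ℚ))) (w : (ZMod (cycLevel 3 0 r))ˣ),
          (w : ZMod (cycLevel 3 0 r)) * ((3 : ℕ) : ZMod (cycLevel 3 0 r)) = 1 →
          ∀ (Ψ : H1 (tateRep W 3) (cycSubgroup 3 0 r) →+
              continuousCohomology 1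
                (subgroupRep (W.torsionGaloisModule (((3 : ℕ) : ℤ) ^ j * ((3 : ℕ) : ℤ))).toTopRep (cycSubgroup 3 0 r))),
            (∀ (φ : contOneCocycles (subgroupRep (tateRep W 3).toTopRep (cycSubgroup 3 0 r)))
                (ψ : contOneCocycles
                  (subgroupRep (W.torsionGaloisModule (((3 : ℕ) : ℤ) ^ j * ((3 : ℕ) : ℤ))).toTopRep (cycSubgroup 3 0 r))),
                (∀ g, ((ψ.1 g : geomTorsion W (((3 : ℕ) : ℤ) ^ j * ((3 : ℕ) : ℤ))) : geomPoints W) =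
                  TateModule.proj 3 (j + 1) (φ.1 g)) →
                Ψ (oneCocycleClass _ φ) = oneCocycleClass _ ψ) →
            ∀ (y : H1 (tateRep W 3) (cycSubgroup 3 0 r))
              (κ₀ : galoisCohomology (W.torsionGaloisModule (((3 : ℕ) : ℤ) ^ j * ((3 : ℕ) : ℤ))) 1) (s : ℤ_[3]),
              resSubgroup (W.torsionGaloisModule (((3 : ℕ) : ℤ) ^ j * ((3 : ℕ) : ℤ))).toTopRep (cycSubgroup 3 0 r) 1 κ₀ =
                  Ψ y →
              galoisCohomology.localization (W.torsionGaloisModule (((3 : ℕ) : ℤ) ^ j * ((3 : ℕ) : ℤ))) (Sum.inr v₃) 1 κ₀ ∈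
                  propagatedSelmerStructure W 3 j (Sum.inr v₃) →
              (∃ l ∈ cycIntLattice 3 (cycLevel 3 0 r),
                  ((3 : ℕ) : ℤ_[3]) • Λ 0 r y -
                      (((s * (((3 : ℕ) : ℤ_[3]) - (t₃ : ℤ_[3]) + 1) : ℤ_[3]) : ℚ_[3]) ⊗ₜ[ℚ]
                        (1 : CyclotomicField (cycLevel 3 0 r) ℚ)) =
                    ((3 : ℤ_[3]) ^ (j + 1)) • ∑ g : (ZMod (cycLevel 3 0 r))ˣ,
                      ((((((3 : ℕ) : MonoidAlgebra ℤ_[3] (ZMod (cycLevel 3 0 r))ˣ)) -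
                          MonoidAlgebra.single w (t₃ : ℤ_[3]) +
                          MonoidAlgebra.single (w ^ 2) (1 : ℤ_[3])).coeff g : ℤ_[3]) : ℚ_[3]) •
                        Algebra.TensorProduct.map (AlgHom.id ℚ ℚ_[3])
                          (sigma (cycLevel 3 0 r) g : CyclotomicField (cycLevel 3 0 r) ℚ →ₐ[ℚ]
                            CyclotomicField (cycLevel 3 0 r) ℚ) l) →
              Λfin j (galoisCohomology.localization (W.torsionGaloisModule (((3 : ℕ) : ℤ) ^ j * ((3 : ℕ) : ℤ)))
                  (Sum.inr v₃) 1 κ₀) = PadicInt.toZModPow (j + 1) s) ∧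

        ∀ (c d a : ℤ) (A : ℕ), 0 < A → Int.gcd c (6 * 3 * A) = 1 → Int.gcd d (6 * 3 * N) = 1 →
          ∃ (z : ∀ (k' : ℕ) (r : (cyclotomicLevelsRat 3 (badPlaces c d A N)).Ideals),
                H1 (tateRep W 3) ((cyclotomicLevelsRat 3 (badPlaces c d A N)).level k' r.1))
            (x : ∀ (k' : ℕ) (r : (cyclotomicLevelsRat 3 (badPlaces c d A N)).Ideals),
                CyclotomicField (cycLevel 3 k' r.1) ℚ),
            ZetaBody W 3 P.f ι κK Λ c d a A z x)
    (η : (q : HeightOneSpectrum (𝓞 ℚ)) → (ZMod (Ideal.absNorm q.asIdeal))ˣ) :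
    ∀ (k k' : ℕ) (D : KolyvaginDatum (W.torsionGaloisModule (((3 : ℕ) : ℤ) ^ k * ((3 : ℕ) : ℤ))))
      (D' : KolyvaginDatum (W.torsionGaloisModule (((3 : ℕ) : ℤ) ^ k' * ((3 : ℕ) : ℤ))))
      (red : (W.torsionGaloisModule (((3 : ℕ) : ℤ) ^ k' * ((3 : ℕ) : ℤ))).toContRepresentation →ⁱL
        (W.torsionGaloisModule (((3 : ℕ) : ℤ) ^ k * ((3 : ℕ) : ℤ))).toContRepresentation),
      D.IsCanonicalTauDatumThreeAtWith W k k η → D'.IsCanonicalTauDatumThreeAtWith W k' k' η → k ≤ k' →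
      (∀ y : geomTorsion W (((3 : ℕ) : ℤ) ^ k' * ((3 : ℕ) : ℤ)),
        ((red y : geomTorsion W (((3 : ℕ) : ℤ) ^ k * ((3 : ℕ) : ℤ))) : geomPoints W) =
          (((3 : ℕ) : ℤ) ^ (k' - k)) • (y : geomPoints W)) →
      ∃ κ Λ₀ κ' κu Λu κu',
        KatoKuriharaWitnessAt W k 0 D v₃ P κ Λ₀ κ' ∧ KatoKuriharaWitnessAt W k' 0 D' v₃ P κu Λu κu' ∧
        ∀ e, D'.IsLevel e → D.IsLevel e →
          galoisCohomology.map red 1 (κu e) = κ e ∧ galoisCohomology.map red 1 (κu' e) = κ' e := by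
  obtain ⟨ι, κK, Λ, Λfin, hκ0, hNorm, hΛ, hfinτ, hz⟩ := hC1
  obtain ⟨c, d, a, A, d', aM, hA, hcA, hdN, hcdA, hcd, hdd', hAN, hA3, haM, haM3, hE0, hE, hR0, hR⟩ :=
    KimAtThreeShallowEqDeepAnomalousCertSupply.certSupply_row_anomalous W (by simpa using hsurj) P ht₃
  haveI : NeZero A := ⟨hA.ne'⟩
  obtain ⟨z, x, hbody⟩ := hz c d a A hA hcA hdN
  -- THEOREM D-u's certificate `ht0` from `#E(ℚ₃)[3] = 1` (transport `ℚ_[3] ≃ ℚ_w`, as in kim3's p448445)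
  have ht0 : ∀ w : HeightOneSpectrum (𝓞 ℚ), ((3 : ℕ) : 𝓞 ℚ) ∈ w.asIdeal →
      ∀ Q : (W.baseChange (w.adicCompletion ℚ)).toAffine.Point, 3 • Q = 0 → Q = 0 := by
    intro w hw Q hQ
    have hw3 : ((primesEquiv w : Nat.Primes) : ℕ) = 3 := primesEquiv_eq_of_natCast_mem Nat.prime_three hw
    have hker := LocalTorsion3.natCard_ker_nsmul_adicCompletion_eq_natCard_torsion_padic W w hw3 3
    rw [ht] at hker
    have hbot := (AddSubgroup.card_eq_one).mp hker
    have hmem : Q ∈ (nsmulAddMonoidHom 3 : (W.baseChange (w.adicCompletion ℚ)).toAffine.Point →+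
        (W.baseChange (w.adicCompletion ℚ)).toAffine.Point).ker := by
      rw [AddMonoidHom.mem_ker, nsmulAddMonoidHom_apply]
      exact hQ
    rw [hbot] at hmem
    exact (AddSubgroup.mem_bot).mp hmem
  refine KimAtThreeShallowEqDeepAnomalousPortOfZetaBody.katoKuriharaPortUnlocked_zero_of_zetaBody_of_unramified_twist
    W P hN hbody hv₃ hsurj Λfin t₃ hΛ hfinτ hcdA ht0 ?_
  intro j σ hI hχ r hr hKol hη'
  have hrow := KimAtThreeShallowEqDeepAnomalousValueRowsOfZetaBody.valueRow_twist_of_zetaBody hbody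
    P.isNewformOf (by decide) (hasIrreducibleModPGaloisRep_of_hasSurjectiveModNGaloisRep W 3 hsurj) hNorm hκ0
    d' hcd hdd' hAN hA3 hN3 aM haM hE0 hE hR0 hR η j σ hI hχ r hr hKol hη'
  rw [haM3] at hrow
  exact hrow

end Row

/-! ### §2–§3 The row conclusions of W2 there (instance binders discharged inside) -/

section Rows

variable (W : WeierstrassCurve ℚ) [W.IsElliptic] [W.IsGloballyMinimal]

set_option backward.isDefEq.respectTransparency false in
/-- **The port of §1 in `KimAtThreeShallowEqDeepPortRows`' two-exponent currency** (`(t, e) = (0, 0)`), the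
Tate-module instance binders DISCHARGED (`TateModule.continuousSMul_padicInt`,
`W.module_free_tateModule_holds 3`, `W.module_finite_tateModule_holds 3`) — so (C1_τ) is stated under
`∀ [ContinuousSMul …] [Module.Free …] [Module.Finite …]`.  Displayed as in §1.
[cite: Kim2022StructureSelmer, Thm. 3.13 (arXiv v3 p. 17)] [cite: Kato2004Asterisque, Thm. 9.7 (p. 189)] -/
theorem portTwoExp_zero_of_fineKatoτ_of_good
    {N : ℕ} [NeZero N] (D : ModularParametrizationData W N) (hN : N = W.conductorNorm ℤ)
    (hsurj : W.HasSurjectiveModNGaloisRep ((3 : ℕ) : ℤ))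
    {v₃ : HeightOneSpectrum (𝓞 ℚ)} (hv₃ : ((3 : ℕ) : 𝓞 ℚ) ∈ v₃.asIdeal)
    (ht : Nat.card {Q : (W.baseChange ℚ_[3]).toAffine.Point // (3 : ℕ) • Q = 0} = 1)
    {t₃ : ℤ} (ht₃ : cuspCoeff D.f 3 = t₃) (hN3 : ¬ 3 ∣ N)
    (hC1 : ∀ [ContinuousSMul ℤ_[3] (W.tateModule 3)] [Module.Free ℤ_[3] (W.tateModule 3)]
      [Module.Finite ℤ_[3] (W.tateModule 3)],
      ∃ (ι : (n : ℕ) → (CyclotomicField n ℚ →+* ℂ)) (κK : ℝ)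
        (Λ : ∀ (k' : ℕ) (r : Finset (HeightOneSpectrum (𝓞 ℚ))),
          H1 (tateRep W 3) (cycSubgroup 3 k' r) →ₗ[ℤ_[3]]
            ℚ_[3] ⊗[ℚ] CyclotomicField (cycLevel 3 k' r) ℚ)
        (Λfin : ∀ j : ℕ, galoisCohomology
          ((W.torsionGaloisModule (((3 : ℕ) : ℤ) ^ j * ((3 : ℕ) : ℤ))).toLocal (Sum.inr v₃)) 1 →+
            ZMod (3 ^ (j + 1))),
        κK ≠ 0 ∧ (∃ u : ℚ, (u : ℝ) = κK ∧ padicValRat 3 u = 0) ∧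
        (∀ j : ℕ, (∀ c : ZMod (3 ^ (j + 1)), ∃ x ∈ propagatedSelmerStructure W 3 j (Sum.inr v₃), Λfin j x = c) ∧
          (∀ x ∈ propagatedSelmerStructure W 3 j (Sum.inr v₃),
            Λfin j x = 0 ↔ x ∈ W.kummerSelmerStructure (((3 : ℕ) : ℤ) ^ j * ((3 : ℕ) : ℤ)) (Sum.inr v₃))) ∧
            (∀ (j : ℕ) (r : Finset (HeightOneSpectrum (𝓞 ℚ))) (w : (ZMod (cycLevel 3 0 r))ˣ),
          (w : ZMod (cycLevel 3 0 r)) * ((3 : ℕ) : ZMod (cycLevel 3 0 r)) = 1 →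
          ∀ (Ψ : H1 (tateRep W 3) (cycSubgroup 3 0 r) →+
              continuousCohomology 1
                (subgroupRep (W.torsionGaloisModule (((3 : ℕ) : ℤ) ^ j * ((3 : ℕ) : ℤ))).toTopRep (cycSubgroup 3 0 r))),
            (∀ (φ : contOneCocycles (subgroupRep (tateRep W 3).toTopRep (cycSubgroup 3 0 r)))
                (ψ : contOneCocycles
                  (subgroupRep (W.torsionGaloisModule (((3 : ℕ) : ℤ) ^ j * ((3 : ℕ) : ℤ))).toTopRep (cycSubgroup 3 0 r))),
                (∀ g, ((ψ.1 g : geomTorsion W (((3 : ℕ) : ℤ) ^ j * ((3 : ℕ) : ℤ))) : geomPoints W) =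
                  TateModule.proj 3 (j + 1) (φ.1 g)) →
                Ψ (oneCocycleClass _ φ) = oneCocycleClass _ ψ) →
            ∀ (y : H1 (tateRep W 3) (cycSubgroup 3 0 r))
              (κ₀ : galoisCohomology (W.torsionGaloisModule (((3 : ℕ) : ℤ) ^ j * ((3 : ℕ) : ℤ))) 1) (s : ℤ_[3]),
              resSubgroup (W.torsionGaloisModule (((3 : ℕ) : ℤ) ^ j * ((3 : ℕ) : ℤ))).toTopRep (cycSubgroup 3 0 r) 1 κ₀ =
                  Ψ y →
              galoisCohomology.localization (W.torsionGaloisModule (((3 : ℕ) : ℤ) ^ j * ((3 : ℕ) : ℤ))) (Sum.inr v₃) 1 κ₀ ∈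
                  propagatedSelmerStructure W 3 j (Sum.inr v₃) →
              (∃ l ∈ cycIntLattice 3 (cycLevel 3 0 r),
                  ((3 : ℕ) : ℤ_[3]) • Λ 0 r y -
                      (((s * (((3 : ℕ) : ℤ_[3]) - (t₃ : ℤ_[3]) + 1) : ℤ_[3]) : ℚ_[3]) ⊗ₜ[ℚ]
                        (1 : CyclotomicField (cycLevel 3 0 r) ℚ)) =
                    ((3 : ℤ_[3]) ^ (j + 1)) • ∑ g : (ZMod (cycLevel 3 0 r))ˣ,
                      ((((((3 : ℕ) : MonoidAlgebra ℤ_[3] (ZMod (cycLevel 3 0 r))ˣ)) -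
                          MonoidAlgebra.single w (t₃ : ℤ_[3]) +
                          MonoidAlgebra.single (w ^ 2) (1 : ℤ_[3])).coeff g : ℤ_[3]) : ℚ_[3]) •
                        Algebra.TensorProduct.map (AlgHom.id ℚ ℚ_[3])
                          (sigma (cycLevel 3 0 r) g : CyclotomicField (cycLevel 3 0 r) ℚ →ₐ[ℚ]
                            CyclotomicField (cycLevel 3 0 r) ℚ) l) →
              Λfin j (galoisCohomology.localization (W.torsionGaloisModule (((3 : ℕ) : ℤ) ^ j * ((3 : ℕ) : ℤ)))
                  (Sum.inr v₃) 1 κ₀) = PadicInt.toZModPow (j + 1) s) ∧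

        ∀ (c d a : ℤ) (A : ℕ), 0 < A → Int.gcd c (6 * 3 * A) = 1 → Int.gcd d (6 * 3 * N) = 1 →
          ∃ (z : ∀ (k' : ℕ) (r : (cyclotomicLevelsRat 3 (badPlaces c d A N)).Ideals),
                H1 (tateRep W 3) ((cyclotomicLevelsRat 3 (badPlaces c d A N)).level k' r.1))
            (x : ∀ (k' : ℕ) (r : (cyclotomicLevelsRat 3 (badPlaces c d A N)).Ideals),
                CyclotomicField (cycLevel 3 k' r.1) ℚ),
            ZetaBody W 3 D.f ι κK Λ c d a A z x)
    (η : (q : HeightOneSpectrum (𝓞 ℚ)) → (ZMod (Ideal.absNorm q.asIdeal))ˣ) :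
    ∀ (k k' : ℕ) (Dk : KolyvaginDatum (W.torsionGaloisModule (((3 : ℕ) : ℤ) ^ k * ((3 : ℕ) : ℤ))))
      (Dk' : KolyvaginDatum (W.torsionGaloisModule (((3 : ℕ) : ℤ) ^ k' * ((3 : ℕ) : ℤ))))
      (red : (W.torsionGaloisModule (((3 : ℕ) : ℤ) ^ k' * ((3 : ℕ) : ℤ))).toContRepresentation →ⁱL
        (W.torsionGaloisModule (((3 : ℕ) : ℤ) ^ k * ((3 : ℕ) : ℤ))).toContRepresentation),
      Dk.IsCanonicalTauDatumThreeAtWith W k k η → Dk'.IsCanonicalTauDatumThreeAtWith W k' k' η → k ≤ k' →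
      (∀ y : geomTorsion W (((3 : ℕ) : ℤ) ^ k' * ((3 : ℕ) : ℤ)),
        ((red y : geomTorsion W (((3 : ℕ) : ℤ) ^ k * ((3 : ℕ) : ℤ))) : geomPoints W) =
          (((3 : ℕ) : ℤ) ^ (k' - k)) • (y : geomPoints W)) →
      ∃ κ Λ₀ κ' κu Λu κu',
        KimAtThreeKolyvaginDefs.KatoKuriharaWitnessAtTwoExp W k 0 0 Dk v₃ D κ Λ₀ κ' ∧
        KimAtThreeKolyvaginDefs.KatoKuriharaWitnessAtTwoExp W k' 0 0 Dk' v₃ D κu Λu κu' ∧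
        ∀ e, Dk'.IsLevel e → Dk.IsLevel e →
          galoisCohomology.map red 1 (κu e) = κ e ∧ galoisCohomology.map red 1 (κu' e) = κ' e := by
  haveI : ContinuousSMul ℤ_[3] (W.tateModule 3) := TateModule.continuousSMul_padicInt
  haveI : Module.Free ℤ_[3] (W.tateModule 3) := W.module_free_tateModule_holds 3
  haveI : Module.Finite ℤ_[3] (W.tateModule 3) := W.module_finite_tateModule_holds 3
  intro k k' Dk Dk' red hDk hDk' hk hred
  obtain ⟨κ, Λ₀, κ', κu, Λu, κu', hW, hW', hcomp⟩ :=
    portUnlocked_zero_of_fineKatoτ_of_good W D hN hsurj hv₃ ht ht₃ hN3 hC1 η k k' Dk Dk' red hDk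
      hDk' hk hred
  exact ⟨κ, Λ₀, κ', κu, Λu, κu', KimAtThreeKolyvaginDefs.katoKuriharaWitnessAtTwoExp_zero_of_witnessAt hW,
    KimAtThreeKolyvaginDefs.katoKuriharaWitnessAtTwoExp_zero_of_witnessAt hW', hcomp⟩

end Rows

end Summit.BirchSwinnertonDyer.BirchSwinnertonDyer.Theorems.KimAtThreeShallowEqDeepAnomalousFineKato

end
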